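import Summits.BirchSwinnertonDyer.Rank1Residual.Additive.CensusX42Bridge
import Summits.BirchSwinnertonDyer.Rank1Residual.Additive.CensusX42BSDMult
import Summits.BirchSwinnertonDyer.Rank1Residual.Additive.GordBranchPAdicGrossZagierOdd
import Summits.BirchSwinnertonDyer.Rank1Residual.Additive.GordRankOneKatoUpperBound
import Summits.BirchSwinnertonDyer.Rank1Residual.AdditivePotMult.PotMultBranchPAdicGrossZagier
import HarnessLib

/-!
# Census relation X4-2 AT THE PAIR ⟹ the typed `p`-adic Gross–Zagier inputs of the n1011 O7-ord
# chain on the ODD branch and on the (M) locus, the Schneider rider, and the weak certificate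
# `c₁ ≠ 0` (cell `b2b-bsdres`, census cell `bsd-formula-census`, seat `b2b-bsdres-census-ctyper1`
# = conjecture-typer 1, gen 4; sequel of `CensusX42Bridge.lean` (gen 2, p253175: the EVEN (G-ord)
# bridge `branchPAdicGrossZagierAt_of_relationAt`) asked for by additive-p2 GEN 19 / n1011-p01 ("the
# bridge to census X42 = census-ctyper1's item", OWNERS T-O7 / HANDOFF l.6670))

HONEST FRAMING (cell `b2b-bsdres`, run/shared/lean/b2b/bsd-rank1-residual/, verbatim in every
file): the goal of the cell is to DELETE the COMBINATION-SHAPED residual classes of the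
Birch–Swinnerton-Dyer formula for ALL analytic-rank `≤ 1` elliptic curves over `ℚ` — "full BSD
formula for every rank `≤ 1` curve in class `C`" assembled STRICTLY from published theorems — so
that the rank-`≤ 1` remainder becomes exactly the CONSTRUCTION-SHAPED classes, which are TYPED
(missing-input `Prop`s), NOT attempted. This is not "finishing BSD". Census cell
(bsd-formula-census): research instrumentation; census output = EVIDENCE / conjecture items, never a
Literature fact; labels / RESIDUAL-MAP marks UNCHANGED (O7 OPEN); nothing booked. THEOREMS ONLY (no
definition, no named fact). The census relation `CensusX42.RelationAt W p Dh` is a HYPOTHESIS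
(CANDIDATE, `@[conjecture]` def of `CensusX42LeadingTerm.lean`; X42-REPORT.md sha256
`e8592c9a2e1a59c13e754928288c9f6b1ce554f7ffb80b93db3c55aa7f5e9950`; LEADERBOARD rows 10–11 'claimed …
until re-scored by a second seat'); the targets `BranchPAdicGrossZagierOddAt` (n1011-p01 p252214),
`BranchPAdicGrossZagierMultAt` (p01 p252800), `BranchCoeffOneNeZeroAt` (additive-p2) and
`SchneiderConjecture Dh` are the tree's typed inputs; Gross–Zagier I.(7.3) (`hGZ`) and GZK (`hGZK`)
enter only to make `#Ш_an` a non-zero rational and `rank E(ℚ) = 1`.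

## What

`CensusX42.RelationAt W p Dh` types, per twist model `V` (`C • V^{(p*)} = W`), newform `f` and
period ratio `ϖ`, on each of its four clauses ((G-ord)/(M) × `p ≡ 1`/`p ≡ 3 (mod 4)`): `c₀ = 0`,
`c₁ ≠ 0`, and `ϖ·c₁·log_p γ_cyc·#T² = ã⁻¹·κ·(#Ш_an·Reg_p(E,Dh)·∏c)` (`ã = α♭` resp. `a_p(E♭) = ±1`,
`κ = 1` resp. `c_∞(E)`). This file reads off:
* §1 `branchCoeffOneNeZeroAt_of_relationAt`: the relation for ONE datum ⟹ additive-p2's weak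
  certificate `BranchCoeffOneNeZeroAt W p` (`ϖ ≠ 0` since `Ω^±_f > 0`) — the `hne` binder of the
  rank-one rider (n1011 T-E3g (ii)/(iii));
* §2 `schneider_of_relationAt[_mult]`: the relation for `Dh` ⟹ `SchneiderConjecture Dh`
  (`Reg_p(E,Dh) ≠ 0`) on the (G-ord, `e = 2`) rows resp. the (M) rows (twist model, newform and
  period ratio are kernel theorems; `#Ш_an ∈ ℚ^×` from `hGZ`/`hGZK`) — the `hSall` rider;
* §3 `branchPAdicGrossZagierOddAt_of_relationAt` (`p ≡ 3 (mod 4)`; `u = α♭⁻¹·c_∞(E) ∈ ℤ_p^×`,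
  `q = #Ш_an·∏c/#T²`) and §4 `branchPAdicGrossZagierMultAt_of_relationAt` (every odd `p`, both
  parities; `u = ã⁻¹` resp. `ã⁻¹·c_∞(E)`, `ã = ±1` read from the split / non-split disjunct by
  `IsNewformOf.cuspCoeff_eq_one_and_sq_of_split` / `…_eq_neg_one_and_dvd_of_nonsplit`).
So on every semistable-twist row of O7-ord (defect `2` both parities, (M) both signs) the census
relation AT THE PAIR discharges BOTH evidence-binders (`hSall`, typed `p`-adic GZ) of n1011-p01's
IMC-version iffs (`BranchPAdicGrossZagierIff.lean`, `X3GordBranchPAdicGrossZagierIff.lean`,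
`X3MBranchPAdicGrossZagier.lean`) and the `hne` binder of the index-`b` capstones — consumers in the
sequel `CensusX42BSDIMC.lean`. EVIDENCE-conditional; nothing about any curve is asserted.

References: B. Mazur, J. Tate, J. Teitelbaum, Invent. Math. 84 (1986) §I.10, §I.13
[MazurTateTeitelbaum1986Invent]; B. Gross, D. Zagier, Invent. Math. 84 (1986) Thm. I.(7.3)
[GrossZagier1986]; P. Schneider, Invent. Math. 69 (1982) §1 [Schneider1982PadicHeightI]; R. L.
Miller, LMS J. Comput. Math. 14 (2011) Def. 1.1 [Miller2011LMS]; J. H. Silverman, AEC (2009) §C.16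
[SilvermanAEC2009]; census files of record (module docstring of `CensusX42LeadingTerm.lean`).
-/

set_option autoImplicit false

noncomputable section

open scoped Classical MatrixGroups ModularForm NumberField

open CongruenceSubgroup WeierstrassCurve NumberField Literature.NumberTheory.EllipticCurves
  Literature.NumberTheory.EllipticCurves.ModularForms
  Literature.NumberTheory.EllipticCurves.Rank1Residual
  Literature.NumberTheory.EllipticCurves.Rank1Residual.Typed
  Literature.NumberTheory.EllipticCurves.Delbourgo2002
  Literature.NumberTheory.GaloisRepresentations
  Summit.BirchSwinnertonDyer.Rank1Residual.AdditivePotMult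
  IsDedekindDomain

namespace Summit.BirchSwinnertonDyer.Rank1Residual.Additive

namespace CensusX42

variable {p : ℕ} [hp : Fact p.Prime]

/-! ### §0 Small bookkeeping -/

omit hp in
/-- A non-zero `p`-adic number of valuation `0` has norm `1`. [folklore] -/
private theorem norm_eq_one_of_valuation_eq_zero [Fact p.Prime] {t : ℚ_[p]} (h0 : t ≠ 0)
    (hv : t.valuation = 0) : ‖t‖ = 1 := by
  rw [Padic.norm_eq_zpow_neg_valuation h0, hv, neg_zero, zpow_zero]

/-- The period ratio of a newform period is non-zero: `ϖ·Ω_V = Ω⁺_f` or `ϖ·|Ω⁻_V| = Ω⁻_f` with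
`Ω^±_f > 0` forces `ϖ ≠ 0`. [folklore] -/
theorem periodRatio_ne_zero {V : WeierstrassCurve ℚ} [V.IsElliptic] [V.IsGloballyMinimal] {N : ℕ}
    [NeZero N] {f : CuspForm (Gamma0 N) 2} (hf : IsNewformOf V f) {ϖ : ℚ}
    (hϖ : if Even (p / 2) then (ϖ : ℝ) * V.realPeriodRat = plusPeriod f
      else (ϖ : ℝ) * V.imaginaryPeriodRat = minusPeriod f) : (ϖ : ℚ_[p]) ≠ 0 := by
  have hϖ0 : ϖ ≠ 0 := by
    rintro rfl
    rw [Rat.cast_zero, zero_mul, zero_mul] at hϖ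
    by_cases h : Even (p / 2)
    · rw [if_pos h] at hϖ
      exact (IsNewform0.plusPeriod_pos_holds hf.1 hf.coeffField_eq_bot).ne hϖ
    · rw [if_neg h] at hϖ
      exact (IsNewform0.minusPeriod_pos_holds hf.1 hf.coeffField_eq_bot).ne hϖ
  exact_mod_cast hϖ0

/-! ### §1 The relation for one datum ⟹ the weak certificate `c₁ ≠ 0` -/

/-- **Census relation AT THE PAIR (any one height datum) ⟹ additive-p2's `BranchCoeffOneNeZeroAt W p`**
(`[T¹](ϖ·B^{±}_{(p−1)/2}) ≠ 0` for every ordinary twist model: the relation's clause `c₁ ≠ 0` times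
`ϖ ≠ 0`). `W = E` globally minimal, additive at the odd prime `p`, `r_an = 1`.
[cite: MazurTateTeitelbaum1986Invent, §I.13] [cite: GrossZagier1986, Thm. I.(7.3)] -/
theorem branchCoeffOneNeZeroAt_of_relationAt (hGZ : GrossZagier1986_thm_I_7_3)
    (hGZK : rank_eq_analyticRank_of_analyticRank_le_one) {W : WeierstrassCurve ℚ} [W.IsElliptic]
    [W.IsGloballyMinimal] (hp2 : p ≠ 2) (hadd : Addv W p) (hr : W.analyticRank = 1)
    {Dh : PAdicHeightData W p} (hrel : RelationAt W p Dh) : BranchCoeffOneNeZeroAt W p := by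
  intro V _ _ C hC hord N _ f hf ϖ hϖ
  obtain ⟨s, -, hs⟩ := X11b.exists_rat_ne_zero_shaAn_eq_of_analyticRank_eq_one hGZ hGZK W hr
  obtain ⟨heven, hodd⟩ := hrel V C f hadd (Or.inl hord.1) hf hr s hs
  have hϖ0 := periodRatio_ne_zero (p := p) hf hϖ
  have hodd4 : p % 4 = 1 ∨ p % 4 = 3 := by
    obtain ⟨k, hk⟩ := hp.out.odd_of_ne_two hp2
    omega
  rcases hodd4 with h1 | h3
  · have hev : Even (p / 2) := ⟨p / 4, by omega⟩
    have hC' : C • V.quadraticTwist (p : ℚ) = W := by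
      rw [pStar_eq_of_mod_four p (Or.inl h1), if_pos h1] at hC; exact hC
    rw [if_pos hev] at hϖ ⊢
    obtain ⟨-, hne, -⟩ := (heven h1 hC' ϖ hϖ).1 hord
    rw [PowerSeries.coeff_C_mul]
    exact mul_ne_zero hϖ0 hne
  · have hnev : ¬ Even (p / 2) := by rw [Nat.not_even_iff_odd]; exact ⟨p / 4, by omega⟩
    have hC' : C • V.quadraticTwist (-(p : ℚ)) = W := by
      rw [pStar_eq_of_mod_four p (Or.inr h3), if_neg (by omega)] at hC; exact hC
    rw [if_neg hnev] at hϖ ⊢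
    obtain ⟨-, hne, -⟩ := (hodd h3 hC' ϖ hϖ).1 hord
    rw [PowerSeries.coeff_C_mul]
    exact mul_ne_zero hϖ0 hne

/-! ### §2 The relation for `Dh` ⟹ `SchneiderConjecture Dh` (the rider `hSall`) -/

/-- **Census relation for `Dh` ⟹ `Reg_p(E,Dh) ≠ 0`, pointwise form**: for any twist model `V` (good
ordinary or multiplicative at `p`), newform and period ratio at which the relation is instantiated.
[cite: MazurTateTeitelbaum1986Invent, §I.10, §I.13] [cite: Schneider1982PadicHeightI, §1] -/
theorem schneider_of_relationAt_of_twist_model (hGZ : GrossZagier1986_thm_I_7_3)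
    (hGZK : rank_eq_analyticRank_of_analyticRank_le_one) {W : WeierstrassCurve ℚ} [W.IsElliptic]
    [W.IsGloballyMinimal] (hp2 : p ≠ 2) (hadd : Addv W p) (hr : W.analyticRank = 1)
    (V : WeierstrassCurve ℚ) [V.IsElliptic] [V.IsGloballyMinimal] (C : VariableChange ℚ)
    (hC : C • V.quadraticTwist ((-1 : ℚ) ^ (p / 2) * p) = W) (hV : IsOrdinaryAt V p ∨ Mult V p)
    {N : ℕ} [NeZero N] {f : CuspForm (Gamma0 N) 2} (hf : IsNewformOf V f) (ϖ : ℚ)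
    (hϖ : if Even (p / 2) then (ϖ : ℝ) * V.realPeriodRat = plusPeriod f
      else (ϖ : ℝ) * V.imaginaryPeriodRat = minusPeriod f)
    {Dh : PAdicHeightData W p} (hrel : RelationAt W p Dh) : SchneiderConjecture Dh := by
  obtain ⟨s, hs0, hs⟩ := X11b.exists_rat_ne_zero_shaAn_eq_of_analyticRank_eq_one hGZ hGZK W hr
  have hgm : Good V p ∨ Mult V p := hV.imp_left fun h ↦ h.1
  obtain ⟨heven, hodd⟩ := hrel V C f hadd hgm hf hr s hs
  have hϖ0 : ϖ ≠ 0 := by exact_mod_cast periodRatio_ne_zero (p := p) hf hϖ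
  obtain ⟨hκ0, -⟩ := numRealComponents_cast_ne_zero_and_valuation (p := p) hp2 W
  have hodd4 : p % 4 = 1 ∨ p % 4 = 3 := by
    obtain ⟨k, hk⟩ := hp.out.odd_of_ne_two hp2
    omega
  rcases hodd4 with h1 | h3
  · have hev : Even (p / 2) := ⟨p / 4, by omega⟩
    have hC' : C • V.quadraticTwist (p : ℚ) = W := by
      rw [pStar_eq_of_mod_four p (Or.inl h1), if_pos h1] at hC; exact hC
    rw [if_pos hev] at hϖ
    obtain ⟨hG, hM⟩ := heven h1 hC' ϖ hϖ
    rcases hV with hord | hmult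
    · obtain ⟨-, hne, hid⟩ := hG hord
      obtain ⟨hu0, -⟩ := unitRoot_inv_ne_zero_and_valuation (p := p) V hord
      exact (coeff_one_ne_zero_iff_padicRegulator_ne_zero p Dh hu0 one_ne_zero hϖ0 hs0
        (by rw [mul_one]; exact hid)).mp hne
    · obtain ⟨-, hne, hid⟩ := hM hmult
      obtain ⟨hu0, -⟩ := intCast_LFunction_inv_ne_zero_and_valuation (p := p) hf hmult
      exact (coeff_one_ne_zero_iff_padicRegulator_ne_zero p Dh hu0 one_ne_zero hϖ0 hs0
        (by rw [mul_one]; exact hid)).mp hne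
  · have hnev : ¬ Even (p / 2) := by rw [Nat.not_even_iff_odd]; exact ⟨p / 4, by omega⟩
    have hC' : C • V.quadraticTwist (-(p : ℚ)) = W := by
      rw [pStar_eq_of_mod_four p (Or.inr h3), if_neg (by omega)] at hC; exact hC
    rw [if_neg hnev] at hϖ
    obtain ⟨hG, hM⟩ := hodd h3 hC' ϖ hϖ
    rcases hV with hord | hmult
    · obtain ⟨-, hne, hid⟩ := hG hord
      obtain ⟨hu0, -⟩ := unitRoot_inv_ne_zero_and_valuation (p := p) V hord
      exact (coeff_one_ne_zero_iff_padicRegulator_ne_zero p Dh hu0 hκ0 hϖ0 hs0 hid).mp hne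
    · obtain ⟨-, hne, hid⟩ := hM hmult
      obtain ⟨hu0, -⟩ := intCast_LFunction_inv_ne_zero_and_valuation (p := p) hf hmult
      exact (coeff_one_ne_zero_iff_padicRegulator_ne_zero p Dh hu0 hκ0 hϖ0 hs0 hid).mp hne

/-- **(G-ord, `e = 2`) rows: census relation for `Dh` ⟹ `SchneiderConjecture Dh`** (`E` additive at
the odd prime `p`, `TypeGOrd`, `e_E(p) = 2`, `r_an = 1`; the good-ordinary twist model, its newform and
the period ratio are kernel theorems). This is the rider `hSall` of p01's IMC-version iffs, discharged
AT THE PAIR by the census relation. [cite: Schneider1982PadicHeightI, §1] [cite: MazurTateTeitelbaum1986Invent, §I.13] -/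
theorem schneider_of_relationAt (hGZ : GrossZagier1986_thm_I_7_3)
    (hGZK : rank_eq_analyticRank_of_analyticRank_le_one)
    (hmodD : nonempty_modularParametrizationData) {W : WeierstrassCurve ℚ} [W.IsElliptic]
    [W.IsGloballyMinimal] (hp2 : p ≠ 2) (hG : TypeGOrd W p) (hadd : Addv W p)
    (he : semistabilityIndex W p = 2) (hr : W.analyticRank = 1)
    {Dh : PAdicHeightData W p} (hrel : RelationAt W p Dh) : SchneiderConjecture Dh := by
  obtain ⟨V, iV, iVm, C, hV, hC⟩ := TypeGOrd.exists_goodOrd_pStar_twist_model W p hp2 hG hadd he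
  haveI : NeZero (V.conductorNorm ℤ) := ⟨(V.conductorNorm_pos_holds).ne'⟩
  obtain ⟨Dm⟩ := hmodD V
  obtain ⟨ϖ, hϖ⟩ := exists_periodRatio_parity (p := p) V Dm
  exact schneider_of_relationAt_of_twist_model hGZ hGZK hp2 hadd hr V C hC (Or.inl hV) Dm.isNewformOf ϖ
    hϖ hrel

/-- **(M) rows: census relation for `Dh` ⟹ `SchneiderConjecture Dh`** (`AdditivePotMult.PotMult W p`:
`E` additive, potentially multiplicative at the odd prime `p`; `r_an = 1`).
[cite: Schneider1982PadicHeightI, §1] [cite: MazurTateTeitelbaum1986Invent, §I.10, §I.13] -/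
theorem schneider_of_relationAt_mult (hGZ : GrossZagier1986_thm_I_7_3)
    (hGZK : rank_eq_analyticRank_of_analyticRank_le_one)
    (hmodD : nonempty_modularParametrizationData) {W : WeierstrassCurve ℚ} [W.IsElliptic]
    [W.IsGloballyMinimal] (hp2 : p ≠ 2) (hpm : AdditivePotMult.PotMult W p) (hr : W.analyticRank = 1)
    {Dh : PAdicHeightData W p} (hrel : RelationAt W p Dh) : SchneiderConjecture Dh := by
  obtain ⟨V, iV, iVm, C, hV, hC⟩ := hpm.exists_mult_pStar_twist_model hp2
  haveI : NeZero (V.conductorNorm ℤ) := ⟨(V.conductorNorm_pos_holds).ne'⟩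
  obtain ⟨Dm⟩ := hmodD V
  obtain ⟨ϖ, hϖ⟩ := exists_periodRatio_parity (p := p) V Dm
  exact schneider_of_relationAt_of_twist_model hGZ hGZK hp2 hpm.1 hr V C hC (Or.inr hV) Dm.isNewformOf ϖ
    hϖ hrel

/-! ### §3 The ODD-branch bridge: census relation ⟹ `BranchPAdicGrossZagierOddAt` (same `Dh`) -/

/-- **Census X4-2 ⟹ `BranchPAdicGrossZagierOddAt` (odd branch, (G-ord), rank 1), same `Dh`,
`u = α♭⁻¹·c_∞(E) ∈ ℤ_p^×`, `q = #Ш_an·∏c/#T²`.** The odd twin of gen 2's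
`branchPAdicGrossZagierAt_of_relationAt`. [cite: GrossZagier1986, Thm. I.(7.3)]
[cite: MazurTateTeitelbaum1986Invent, §I.13] -/
theorem branchPAdicGrossZagierOddAt_of_relationAt (hGZ : GrossZagier1986_thm_I_7_3)
    (hGZK : rank_eq_analyticRank_of_analyticRank_le_one)
    (W : WeierstrassCurve ℚ) [W.IsElliptic] [W.IsGloballyMinimal] (hp2 : p ≠ 2) (hadd : Addv W p)
    (hr : W.analyticRank = 1) (Dh : PAdicHeightData W p) (h : RelationAt W p Dh) :
    BranchPAdicGrossZagierOddAt W p Dh := by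
  intro V _ _ N _ f hp4 hVW hV hf ϖ hϖ
  obtain ⟨C, hC⟩ := hVW
  obtain ⟨s, hs0, hs⟩ := X11b.exists_rat_ne_zero_shaAn_eq_of_analyticRank_eq_one hGZ hGZK W hr
  have hord : IsOrdinaryAt V p := hV
  obtain ⟨-, hodd⟩ := h V C f hadd (Or.inl hord.1) hf hr s hs
  obtain ⟨hG, -⟩ := hodd hp4 hC ϖ hϖ
  obtain ⟨-, -, hid⟩ := hG hord
  have hrk : W.mordellWeilRank = 1 := by rw [(hGZK W hr.le).1, hr]
  obtain ⟨hu0, hu⟩ := unitRoot_inv_ne_zero_and_valuation (p := p) V hord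
  obtain ⟨hκ0, hκ⟩ := numRealComponents_cast_ne_zero_and_valuation (p := p) hp2 W
  have hnorm : ‖((unitRoot V p : ℤ_[p]) : ℚ_[p])⁻¹ * ((W.baseChange ℝ).numRealComponents : ℚ_[p])‖ = 1 := by
    rw [norm_mul, norm_eq_one_of_valuation_eq_zero hu0 hu, norm_eq_one_of_valuation_eq_zero hκ0 hκ,
      mul_one]
  have hT : (W.torsionOrder : ℚ_[p]) ≠ 0 := by exact_mod_cast (W.torsionOrder_pos_holds).ne'
  refine ⟨PadicInt.mkUnits hnorm, s * W.tamagawaProduct / (W.torsionOrder : ℚ) ^ 2,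
    leadingLCoeff_eq_of_shaAn_eq W hs, ?_⟩
  rw [hrk, pow_one, PadicInt.mkUnits_eq]
  have hgoal : ((ϖ : ℚ) : ℚ_[p]) *
      PowerSeries.coeff 1 (padicLFunctionMinusBranch f ((unitRoot V p : ℤ_[p]) : ℚ_[p]) (p / 2)) *
      padicLog p (cyclotomicGenerator p) =
      ((unitRoot V p : ℤ_[p]) : ℚ_[p])⁻¹ * ((W.baseChange ℝ).numRealComponents : ℚ_[p]) *
        ((s * W.tamagawaProduct / (W.torsionOrder : ℚ) ^ 2 : ℚ) : ℚ_[p]) * padicRegulator Dh := by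
    push_cast
    field_simp
    linear_combination hid
  exact hgoal

/-! ### §4 The (M) bridge: census relation ⟹ `BranchPAdicGrossZagierMultAt` (same `Dh`) -/

/-- `a_p(V) = 1` on a split multiplicative `V`, `= −1` on a non-split one (as the integer
`V.LFunction p` of the newform dictionary `hf.2`). [cite: SilvermanAEC2009, §C.16] -/
theorem intCast_LFunction_eq_of_split_or_nonsplit {V : WeierstrassCurve ℚ} [V.IsElliptic]
    [V.IsGloballyMinimal] {N : ℕ} [NeZero N] {f : CuspForm (Gamma0 N) 2} (hf : IsNewformOf V f) :
    (V.HasSplitMultiplicativeReductionAtPrime p → (V.LFunction p : ℤ) = 1) ∧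
      (V.HasMultiplicativeReductionAtPrime p → ¬ V.HasSplitMultiplicativeReductionAtPrime p →
        (V.LFunction p : ℤ) = -1) := by
  have hcoef : cuspCoeff f p = ((V.LFunction p : ℤ) : ℂ) := hf.2 p
  refine ⟨fun hs ↦ ?_, fun hm hns ↦ ?_⟩
  · obtain ⟨h1, -⟩ := hf.cuspCoeff_eq_one_and_sq_of_split hs
    have h : ((V.LFunction p : ℤ) : ℂ) = ((1 : ℤ) : ℂ) := by rw [← hcoef, h1, Int.cast_one]
    exact_mod_cast h
  · obtain ⟨h1, -⟩ := hf.cuspCoeff_eq_neg_one_and_dvd_of_nonsplit hm hns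
    have h : ((V.LFunction p : ℤ) : ℂ) = ((-1 : ℤ) : ℂ) := by
      rw [← hcoef, h1, Int.cast_neg, Int.cast_one]
    exact_mod_cast h

/-- **Census X4-2 ⟹ `BranchPAdicGrossZagierMultAt` ((M) locus, rank 1, EVERY odd `p`, both
parities), same `Dh`, `u = ã⁻¹` (`p ≡ 1`) resp. `ã⁻¹·c_∞(E)` (`p ≡ 3 (mod 4)`), `ã = a_p(E♭) = ±1`,
`q = #Ш_an·∏c/#T²`.** [cite: GrossZagier1986, Thm. I.(7.3)] [cite: MazurTateTeitelbaum1986Invent, §I.10, §I.13] -/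
theorem branchPAdicGrossZagierMultAt_of_relationAt (hGZ : GrossZagier1986_thm_I_7_3)
    (hGZK : rank_eq_analyticRank_of_analyticRank_le_one)
    (W : WeierstrassCurve ℚ) [W.IsElliptic] [W.IsGloballyMinimal] (hadd : Addv W p)
    (hr : W.analyticRank = 1) (Dh : PAdicHeightData W p) (h : RelationAt W p Dh) :
    BranchPAdicGrossZagierMultAt W p Dh := by
  intro V _ _ N _ f B hp2 hVW hB hf ϖ hϖ
  obtain ⟨C, hC⟩ := hVW
  obtain ⟨s, hs0, hs⟩ := X11b.exists_rat_ne_zero_shaAn_eq_of_analyticRank_eq_one hGZ hGZK W hr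
  -- the multiplicative model and its `ã = ±1`
  obtain ⟨hsplit, hnonsplit⟩ := intCast_LFunction_eq_of_split_or_nonsplit (p := p) hf
  have hVB : Mult V p ∧ B = (if Even (p / 2)
      then padicLFunctionPlusBranchMult f (((V.LFunction p : ℤ)) : ℚ_[p]) (p / 2)
      else padicLFunctionMinusBranchMult f (((V.LFunction p : ℤ)) : ℚ_[p]) (p / 2)) := by
    rcases hB with ⟨hs', hB⟩ | ⟨hm, hns, hB⟩
    · exact ⟨hs'.hasMultiplicativeReductionAtPrime, by rw [hB, hsplit hs', Int.cast_one]⟩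
    · exact ⟨hm, by rw [hB, hnonsplit hm hns, Int.cast_neg, Int.cast_one]⟩
  obtain ⟨hV, rfl⟩ := hVB
  obtain ⟨heven, hodd⟩ := h V C f hadd (Or.inr hV) hf hr s hs
  have hrk : W.mordellWeilRank = 1 := by rw [(hGZK W hr.le).1, hr]
  obtain ⟨hu0, hu⟩ := intCast_LFunction_inv_ne_zero_and_valuation (p := p) hf hV
  obtain ⟨hκ0, hκ⟩ := numRealComponents_cast_ne_zero_and_valuation (p := p) hp2 W
  have hT : (W.torsionOrder : ℚ_[p]) ≠ 0 := by exact_mod_cast (W.torsionOrder_pos_holds).ne'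
  have hodd4 : p % 4 = 1 ∨ p % 4 = 3 := by
    obtain ⟨k, hk⟩ := hp.out.odd_of_ne_two hp2
    omega
  rcases hodd4 with h1 | h3
  · -- `p ≡ 1 (mod 4)`: even one-term branch, `u = ã⁻¹`
    have hev : Even (p / 2) := ⟨p / 4, by omega⟩
    have hC' : C • V.quadraticTwist (p : ℚ) = W := by
      rw [pStar_eq_of_mod_four p (Or.inl h1), if_pos h1] at hC; exact hC
    rw [if_pos hev] at hϖ ⊢
    obtain ⟨-, -, hid⟩ := (heven h1 hC' ϖ hϖ).2 hV
    have hnorm : ‖((((V.LFunction p : ℤ)) : ℚ_[p]))⁻¹‖ = 1 := norm_eq_one_of_valuation_eq_zero hu0 hu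
    refine ⟨PadicInt.mkUnits hnorm, s * W.tamagawaProduct / (W.torsionOrder : ℚ) ^ 2,
      leadingLCoeff_eq_of_shaAn_eq W hs, ?_⟩
    rw [hrk, pow_one, PadicInt.mkUnits_eq]
    have hgoal : ((ϖ : ℚ) : ℚ_[p]) *
        PowerSeries.coeff 1
          (padicLFunctionPlusBranchMult f (((V.LFunction p : ℤ)) : ℚ_[p]) (p / 2)) *
        padicLog p (cyclotomicGenerator p) =
        ((((V.LFunction p : ℤ)) : ℚ_[p]))⁻¹ *
          ((s * W.tamagawaProduct / (W.torsionOrder : ℚ) ^ 2 : ℚ) : ℚ_[p]) * padicRegulator Dh := by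
      push_cast
      field_simp
      linear_combination hid
    exact hgoal
  · -- `p ≡ 3 (mod 4)`: odd one-term branch, `u = ã⁻¹·c_∞(E)`
    have hnev : ¬ Even (p / 2) := by rw [Nat.not_even_iff_odd]; exact ⟨p / 4, by omega⟩
    have hC' : C • V.quadraticTwist (-(p : ℚ)) = W := by
      rw [pStar_eq_of_mod_four p (Or.inr h3), if_neg (by omega)] at hC; exact hC
    rw [if_neg hnev] at hϖ ⊢
    obtain ⟨-, -, hid⟩ := (hodd h3 hC' ϖ hϖ).2 hV
    have hnorm : ‖((((V.LFunction p : ℤ)) : ℚ_[p]))⁻¹ *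
        ((W.baseChange ℝ).numRealComponents : ℚ_[p])‖ = 1 := by
      rw [norm_mul, norm_eq_one_of_valuation_eq_zero hu0 hu, norm_eq_one_of_valuation_eq_zero hκ0 hκ,
        mul_one]
    refine ⟨PadicInt.mkUnits hnorm, s * W.tamagawaProduct / (W.torsionOrder : ℚ) ^ 2,
      leadingLCoeff_eq_of_shaAn_eq W hs, ?_⟩
    rw [hrk, pow_one, PadicInt.mkUnits_eq]
    have hgoal : ((ϖ : ℚ) : ℚ_[p]) *
        PowerSeries.coeff 1
          (padicLFunctionMinusBranchMult f (((V.LFunction p : ℤ)) : ℚ_[p]) (p / 2)) *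
        padicLog p (cyclotomicGenerator p) =
        ((((V.LFunction p : ℤ)) : ℚ_[p]))⁻¹ * ((W.baseChange ℝ).numRealComponents : ℚ_[p]) *
          ((s * W.tamagawaProduct / (W.torsionOrder : ℚ) ^ 2 : ℚ) : ℚ_[p]) * padicRegulator Dh := by
      push_cast
      field_simp
      linear_combination hid
    exact hgoal

end CensusX42

end Summit.BirchSwinnertonDyer.Rank1Residual.Additive

end
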